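import Mathlib
import Summits.NavierStokesRegularity.NavierStokesRegularity.Theorems.EulerZoomLiouvillePowerGaugeEulerLiouvilleCondenserPlaneCore

/-!
# THE `ℂ`-CHART OF A COORDINATE PLANE OF `ℝ³` (plate t47-X, nsreg-p2 g35 ROUND-45 §6)

Width piece for crux `EulerZoomLiouville.PowerGaugeEulerLiouville` (stmt-NavierStokesRegularity-19832), by name under
LEAD 19832 (ns-typeII-p2 g13); seat ns-sfl-p1 g6, `--supports stmt-NavierStokesRegularity-19832 --as helper`.
Glue between the planar capacity lemmas over `ℂ` (t42b `…NeedleAnnulusCapacity`, t46-F/G `…CondenserCircleMeanCapacity`,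
t47-C `CircleMeanCondenserCore`) and the slices `Condenser.plane s a = (a 0, a 1, s)` of `ℝ³` (t42-QP): the chart of the
plane `{x 2 = y 2}` through `y` is written, WITHOUT a new definition, as
`Φ_y z := y + z.re • e₀ + z.im • e₁` (`eᵢ = EuclideanSpace.basisFun (Fin 3) ℝ i`) — the `ℂ`-version of the `ℝ × ℝ`
chart of `Condenser.chart_eq_plane` (which carried the sup norm of `ℝ × ℝ`; here discs are Euclidean discs).

* `cchart_eq_plane` — `Φ_y z = plane (y 2) (toLp ![y 0, y 1] + toLp ![z.re, z.im])`; `cchart_zero` — `Φ_y 0 = y`;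
* `norm_cchartLin`, `norm_cchart_sub_cchart` — the linear part `ι z = z.re • e₀ + z.im • e₁` and `Φ_y` are isometric;
* `hasFDerivAt_cchart`, `norm_fderiv_comp_cchart_le`, `contDiff_comp_cchart` — `DΦ_y = ι`, so
  `‖D(f ∘ Φ_y)(z)‖ ≤ ‖Df(Φ_y z)‖` for differentiable `f : ℝ³ → F`;
* `norm_fderiv_inner_const_le` — for `V : ℝ³ → ℝ³` and `‖u‖ ≤ 1`, `‖D⟪V, u⟫‖ ≤ ‖DV‖`; with the two previous items the
  scalar `ψ z = ⟪V(Φ_y z), u⟫` has `‖Dψ z‖ ≤ ‖DV(Φ_y z)‖`, `ψ z² ≤ ‖V(Φ_y z)‖²` (`sq_inner_le_norm_sq`);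
* **`setIntegral_cdisc_le_integral_plane`** — DISC ≤ SLICE: for continuous `G ≥ 0` and `‖y‖ + r < R'`,
  `∫_{closedBall (0:ℂ) r} G(Φ_y z) dz ≤ ∫ a, 𝟙_{B(0,R')} G (plane (y 2) a)`
  (`Complex.volume_preserving_equiv_real_prod` + `measurePreserving_planeChart`);
* `setIntegral_cdisc_sq_inner_le`, `setIntegral_cdisc_sq_norm_fderiv_inner_le` — the disc amplitude / energy budgets
  of `ψ = ⟪V ∘ Φ_y, u⟫` are at most the truncated slice budgets of `‖V‖²` / `‖DV‖²`.

HONEST FRAMING: real analysis in `ℝ³`; nothing here proves the crux E (19832 OPEN), any door Target, or any Navier–Stokes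
statement; no summit statement is touched. [folklore]
-/

noncomputable section

open Set Filter Topology Metric Function MeasureTheory Real Complex
open scoped RealInnerProductSpace

set_option linter.dupNamespace false

namespace Summit.NavierStokesRegularity.NavierStokesRegularity.Theorems.PowerGaugeEulerLiouville.Condenser

/-! ## §1 The chart and the slicing map -/

/-- The `ℂ`-chart of the coordinate plane through `y` is a slice of t42-QP's `plane`:
`y + z.re•e₀ + z.im•e₁ = plane (y 2) (toLp ![y 0, y 1] + toLp ![z.re, z.im])`. [folklore] -/
theorem cchart_eq_plane (y : EuclideanSpace ℝ (Fin 3)) (z : ℂ) :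
    y + z.re • EuclideanSpace.basisFun (Fin 3) ℝ 0 + z.im • EuclideanSpace.basisFun (Fin 3) ℝ 1 =
      plane (y 2) ((WithLp.toLp 2 ![y 0, y 1] : EuclideanSpace ℝ (Fin 2)) +
        WithLp.toLp 2 ((MeasurableEquiv.finTwoArrow (α := ℝ)).symm (z.re, z.im))) :=
  chart_eq_plane y (z.re, z.im)

/-- The chart is centred at `y`: `Φ_y 0 = y`. [folklore] -/
theorem cchart_zero (y : EuclideanSpace ℝ (Fin 3)) :
    y + (0 : ℂ).re • EuclideanSpace.basisFun (Fin 3) ℝ 0 + (0 : ℂ).im • EuclideanSpace.basisFun (Fin 3) ℝ 1 = y := by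
  simp

/-- The linear part `ι z = z.re • e₀ + z.im • e₁` of the chart is isometric: `‖ι z‖ = ‖z‖`. [folklore] -/
theorem norm_cchartLin (z : ℂ) :
    ‖z.re • EuclideanSpace.basisFun (Fin 3) ℝ 0 + z.im • EuclideanSpace.basisFun (Fin 3) ℝ 1‖ = ‖z‖ := by
  have h2 : ‖z.re • EuclideanSpace.basisFun (Fin 3) ℝ 0 + z.im • EuclideanSpace.basisFun (Fin 3) ℝ 1‖ ^ 2 = ‖z‖ ^ 2 := by
    rw [EuclideanSpace.norm_sq_eq, Fin.sum_univ_three, Complex.sq_norm, Complex.normSq_apply]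
    simp [EuclideanSpace.basisFun_apply]
    ring
  have h0 : 0 ≤ ‖z.re • EuclideanSpace.basisFun (Fin 3) ℝ 0 + z.im • EuclideanSpace.basisFun (Fin 3) ℝ 1‖ := norm_nonneg _
  nlinarith [norm_nonneg z, h2]

/-- The chart is an affine isometry: `‖Φ_y z − Φ_y z'‖ = ‖z − z'‖`. [folklore] -/
theorem norm_cchart_sub_cchart (y : EuclideanSpace ℝ (Fin 3)) (z z' : ℂ) :
    ‖(y + z.re • EuclideanSpace.basisFun (Fin 3) ℝ 0 + z.im • EuclideanSpace.basisFun (Fin 3) ℝ 1) -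
        (y + z'.re • EuclideanSpace.basisFun (Fin 3) ℝ 0 + z'.im • EuclideanSpace.basisFun (Fin 3) ℝ 1)‖ = ‖z - z'‖ := by
  have h : (y + z.re • EuclideanSpace.basisFun (Fin 3) ℝ 0 + z.im • EuclideanSpace.basisFun (Fin 3) ℝ 1) -
      (y + z'.re • EuclideanSpace.basisFun (Fin 3) ℝ 0 + z'.im • EuclideanSpace.basisFun (Fin 3) ℝ 1) =
      (z - z').re • EuclideanSpace.basisFun (Fin 3) ℝ 0 + (z - z').im • EuclideanSpace.basisFun (Fin 3) ℝ 1 := by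
    rw [Complex.sub_re, Complex.sub_im, sub_smul, sub_smul]
    abel
  rw [h, norm_cchartLin]

/-- The norm of a chart point: `‖Φ_y z‖ ≤ ‖y‖ + ‖z‖`. [folklore] -/
theorem norm_cchart_le (y : EuclideanSpace ℝ (Fin 3)) (z : ℂ) :
    ‖y + z.re • EuclideanSpace.basisFun (Fin 3) ℝ 0 + z.im • EuclideanSpace.basisFun (Fin 3) ℝ 1‖ ≤ ‖y‖ + ‖z‖ := by
  rw [add_assoc]
  exact (norm_add_le _ _).trans (by rw [norm_cchartLin])

/-! ## §2 Derivatives through the chart -/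

/-- The linear part of the chart as a continuous linear map `ι = re•e₀ + im•e₁`. -/
theorem cchartLin_apply (w : ℂ) :
    (Complex.reCLM.smulRight (EuclideanSpace.basisFun (Fin 3) ℝ 0) +
        Complex.imCLM.smulRight (EuclideanSpace.basisFun (Fin 3) ℝ 1)) w =
      w.re • EuclideanSpace.basisFun (Fin 3) ℝ 0 + w.im • EuclideanSpace.basisFun (Fin 3) ℝ 1 := by
  simp [ContinuousLinearMap.smulRight_apply]

/-- The operator norm of the linear part is `≤ 1` (in fact `= 1`). [folklore] -/
theorem opNorm_cchartLin_le :
    ‖Complex.reCLM.smulRight (EuclideanSpace.basisFun (Fin 3) ℝ 0) +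
        Complex.imCLM.smulRight (EuclideanSpace.basisFun (Fin 3) ℝ 1)‖ ≤ 1 := by
  refine ContinuousLinearMap.opNorm_le_bound _ zero_le_one fun w => ?_
  rw [cchartLin_apply, norm_cchartLin, one_mul]

/-- The chart has derivative `ι` everywhere. [folklore] -/
theorem hasFDerivAt_cchart (y : EuclideanSpace ℝ (Fin 3)) (z : ℂ) :
    HasFDerivAt (fun z : ℂ => y + z.re • EuclideanSpace.basisFun (Fin 3) ℝ 0 + z.im • EuclideanSpace.basisFun (Fin 3) ℝ 1)
      (Complex.reCLM.smulRight (EuclideanSpace.basisFun (Fin 3) ℝ 0) +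
        Complex.imCLM.smulRight (EuclideanSpace.basisFun (Fin 3) ℝ 1)) z := by
  have hfun : (fun z : ℂ => y + z.re • EuclideanSpace.basisFun (Fin 3) ℝ 0 + z.im • EuclideanSpace.basisFun (Fin 3) ℝ 1) =
      fun z : ℂ => y + (Complex.reCLM.smulRight (EuclideanSpace.basisFun (Fin 3) ℝ 0) +
        Complex.imCLM.smulRight (EuclideanSpace.basisFun (Fin 3) ℝ 1)) z := by
    funext z; rw [cchartLin_apply, add_assoc]
  rw [hfun]
  exact (Complex.reCLM.smulRight (EuclideanSpace.basisFun (Fin 3) ℝ 0) +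
    Complex.imCLM.smulRight (EuclideanSpace.basisFun (Fin 3) ℝ 1)).hasFDerivAt.const_add y

/-- The chart is smooth. [folklore] -/
theorem contDiff_cchart (y : EuclideanSpace ℝ (Fin 3)) {n : WithTop ℕ∞} :
    ContDiff ℝ n
      (fun z : ℂ => y + z.re • EuclideanSpace.basisFun (Fin 3) ℝ 0 + z.im • EuclideanSpace.basisFun (Fin 3) ℝ 1) :=
  (contDiff_const.add (Complex.reCLM.contDiff.smul contDiff_const)).add (Complex.imCLM.contDiff.smul contDiff_const)

/-- A `Cⁿ` function composed with the chart is `Cⁿ`. [folklore] -/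
theorem contDiff_comp_cchart {F : Type*} [NormedAddCommGroup F] [NormedSpace ℝ F] {f : EuclideanSpace ℝ (Fin 3) → F}
    {n : WithTop ℕ∞} (hf : ContDiff ℝ n f) (y : EuclideanSpace ℝ (Fin 3)) :
    ContDiff ℝ n (fun z : ℂ =>
      f (y + z.re • EuclideanSpace.basisFun (Fin 3) ℝ 0 + z.im • EuclideanSpace.basisFun (Fin 3) ℝ 1)) :=
  hf.comp (contDiff_cchart y)

/-- **Chain rule through the chart**: for differentiable `f : ℝ³ → F`,
`D(f ∘ Φ_y)(z) = Df(Φ_y z) ∘ ι` and hence `‖D(f ∘ Φ_y)(z)‖ ≤ ‖Df(Φ_y z)‖`. [folklore] -/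
theorem norm_fderiv_comp_cchart_le {F : Type*} [NormedAddCommGroup F] [NormedSpace ℝ F]
    {f : EuclideanSpace ℝ (Fin 3) → F} (hf : Differentiable ℝ f) (y : EuclideanSpace ℝ (Fin 3)) (z : ℂ) :
    ‖fderiv ℝ (fun z : ℂ =>
        f (y + z.re • EuclideanSpace.basisFun (Fin 3) ℝ 0 + z.im • EuclideanSpace.basisFun (Fin 3) ℝ 1)) z‖ ≤
      ‖fderiv ℝ f (y + z.re • EuclideanSpace.basisFun (Fin 3) ℝ 0 + z.im • EuclideanSpace.basisFun (Fin 3) ℝ 1)‖ := by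
  have h : HasFDerivAt (fun z : ℂ =>
      f (y + z.re • EuclideanSpace.basisFun (Fin 3) ℝ 0 + z.im • EuclideanSpace.basisFun (Fin 3) ℝ 1))
      ((fderiv ℝ f (y + z.re • EuclideanSpace.basisFun (Fin 3) ℝ 0 + z.im • EuclideanSpace.basisFun (Fin 3) ℝ 1)).comp
        (Complex.reCLM.smulRight (EuclideanSpace.basisFun (Fin 3) ℝ 0) +
          Complex.imCLM.smulRight (EuclideanSpace.basisFun (Fin 3) ℝ 1))) z :=
    (hf _).hasFDerivAt.comp z (hasFDerivAt_cchart y z)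
  rw [h.fderiv]
  calc ‖(fderiv ℝ f (y + z.re • EuclideanSpace.basisFun (Fin 3) ℝ 0 + z.im • EuclideanSpace.basisFun (Fin 3) ℝ 1)).comp
        (Complex.reCLM.smulRight (EuclideanSpace.basisFun (Fin 3) ℝ 0) +
          Complex.imCLM.smulRight (EuclideanSpace.basisFun (Fin 3) ℝ 1))‖
      ≤ ‖fderiv ℝ f (y + z.re • EuclideanSpace.basisFun (Fin 3) ℝ 0 + z.im • EuclideanSpace.basisFun (Fin 3) ℝ 1)‖ *
          ‖Complex.reCLM.smulRight (EuclideanSpace.basisFun (Fin 3) ℝ 0) +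
            Complex.imCLM.smulRight (EuclideanSpace.basisFun (Fin 3) ℝ 1)‖ :=
        ContinuousLinearMap.opNorm_comp_le _ _
    _ ≤ ‖fderiv ℝ f (y + z.re • EuclideanSpace.basisFun (Fin 3) ℝ 0 + z.im • EuclideanSpace.basisFun (Fin 3) ℝ 1)‖ :=
        mul_le_of_le_one_right (norm_nonneg _) opNorm_cchartLin_le

/-! ## §3 The scalar `⟪V, u⟫` -/

/-- For a differentiable field `V` and a vector `u` with `‖u‖ ≤ 1`: `‖D⟪V, u⟫(x)‖ ≤ ‖DV(x)‖`. [folklore] -/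
theorem norm_fderiv_inner_const_le {H : Type*} [NormedAddCommGroup H] [NormedSpace ℝ H]
    {V : H → EuclideanSpace ℝ (Fin 3)} (hV : Differentiable ℝ V) {u : EuclideanSpace ℝ (Fin 3)} (hu : ‖u‖ ≤ 1)
    (x : H) : ‖fderiv ℝ (fun x => ⟪V x, u⟫) x‖ ≤ ‖fderiv ℝ V x‖ := by
  have hfun : (fun x => ⟪V x, u⟫) = fun x => innerSL ℝ u (V x) := by
    funext x; rw [innerSL_apply_apply]; exact real_inner_comm _ _
  have h : HasFDerivAt (fun x => innerSL ℝ u (V x)) ((innerSL ℝ u).comp (fderiv ℝ V x)) x :=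
    (innerSL ℝ u).hasFDerivAt.comp x (hV x).hasFDerivAt
  rw [hfun, h.fderiv]
  calc ‖(innerSL ℝ u).comp (fderiv ℝ V x)‖ ≤ ‖innerSL ℝ u‖ * ‖fderiv ℝ V x‖ := ContinuousLinearMap.opNorm_comp_le _ _
    _ ≤ 1 * ‖fderiv ℝ V x‖ := by
        refine mul_le_mul_of_nonneg_right ?_ (norm_nonneg _)
        rw [innerSL_apply_norm]; exact hu
    _ = ‖fderiv ℝ V x‖ := one_mul _

/-- `⟪v, u⟫² ≤ ‖v‖²` for `‖u‖ ≤ 1`. [folklore] -/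
theorem sq_inner_le_norm_sq (v : EuclideanSpace ℝ (Fin 3)) {u : EuclideanSpace ℝ (Fin 3)} (hu : ‖u‖ ≤ 1) :
    ⟪v, u⟫ ^ 2 ≤ ‖v‖ ^ 2 := by
  have h1 : |⟪v, u⟫| ≤ ‖v‖ * ‖u‖ := abs_real_inner_le_norm v u
  have h2 : ‖v‖ * ‖u‖ ≤ ‖v‖ := mul_le_of_le_one_right (norm_nonneg _) hu
  have h3 : |⟪v, u⟫| ≤ ‖v‖ := h1.trans h2
  calc ⟪v, u⟫ ^ 2 = |⟪v, u⟫| ^ 2 := (sq_abs _).symm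
    _ ≤ ‖v‖ ^ 2 := pow_le_pow_left₀ (abs_nonneg _) h3 2

/-- **The scalar through the chart.**  For `V ∈ C¹(ℝ³,ℝ³)`, `‖u‖ ≤ 1` and `ψ z = ⟪V(Φ_y z), u⟫`:
`‖Dψ(z)‖ ≤ ‖DV(Φ_y z)‖`. [folklore] -/
theorem norm_fderiv_inner_comp_cchart_le {V : EuclideanSpace ℝ (Fin 3) → EuclideanSpace ℝ (Fin 3)}
    (hV : Differentiable ℝ V) {u : EuclideanSpace ℝ (Fin 3)} (hu : ‖u‖ ≤ 1) (y : EuclideanSpace ℝ (Fin 3)) (z : ℂ) :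
    ‖fderiv ℝ (fun z : ℂ =>
        ⟪V (y + z.re • EuclideanSpace.basisFun (Fin 3) ℝ 0 + z.im • EuclideanSpace.basisFun (Fin 3) ℝ 1), u⟫) z‖ ≤
      ‖fderiv ℝ V (y + z.re • EuclideanSpace.basisFun (Fin 3) ℝ 0 + z.im • EuclideanSpace.basisFun (Fin 3) ℝ 1)‖ := by
  have hf : Differentiable ℝ fun x => ⟪V x, u⟫ := (hV.inner ℝ (differentiable_const u))
  exact (norm_fderiv_comp_cchart_le hf y z).trans (norm_fderiv_inner_const_le hV hu _)

/-! ## §4 Disc integrals are slice integrals -/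

/-- The chart `z ↦ toLp ![y 0, y 1] + toLp ![z.re, z.im] : ℂ → E²` preserves Lebesgue measure. [folklore] -/
theorem measurePreserving_cplaneChart (c : EuclideanSpace ℝ (Fin 2)) :
    MeasurePreserving (fun z : ℂ =>
      c + (WithLp.toLp 2 ((MeasurableEquiv.finTwoArrow (α := ℝ)).symm (z.re, z.im)) : EuclideanSpace ℝ (Fin 2)))
      volume volume :=
  (measurePreserving_planeChart c).comp Complex.volume_preserving_equiv_real_prod

/-- **DISC ≤ SLICE.**  For continuous `G ≥ 0` on `ℝ³` and `‖y‖ + r < R'`: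
`∫_{closedBall (0:ℂ) r} G(Φ_y z) dz ≤ ∫ a, 𝟙_{B(0,R')} G (plane (y 2) a)` — the Euclidean disc of radius `r` about `y`
in its coordinate plane carries at most the truncated slice integral of t42-QP. [folklore] -/
theorem setIntegral_cdisc_le_integral_plane {G : EuclideanSpace ℝ (Fin 3) → ℝ} (hGc : Continuous G)
    (hG0 : ∀ x, 0 ≤ G x) {y : EuclideanSpace ℝ (Fin 3)} {R' r : ℝ} (hfit : ‖y‖ + r < R') :
    ∫ z in closedBall (0 : ℂ) r,
        G (y + z.re • EuclideanSpace.basisFun (Fin 3) ℝ 0 + z.im • EuclideanSpace.basisFun (Fin 3) ℝ 1) ≤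
      ∫ a, (ball (0 : EuclideanSpace ℝ (Fin 3)) R').indicator G (plane (y 2) a) := by
  set s : ℝ := y 2 with hs
  set c : EuclideanSpace ℝ (Fin 2) := WithLp.toLp 2 ![y 0, y 1] with hc
  set Φ : ℂ → EuclideanSpace ℝ (Fin 2) := fun z =>
    c + (WithLp.toLp 2 ((MeasurableEquiv.finTwoArrow (α := ℝ)).symm (z.re, z.im)) : EuclideanSpace ℝ (Fin 2))
    with hΦ
  have hΦmp : MeasurePreserving Φ volume volume := measurePreserving_cplaneChart c
  set h : EuclideanSpace ℝ (Fin 2) → ℝ := fun a =>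
    (ball (0 : EuclideanSpace ℝ (Fin 3)) R').indicator G (plane s a) with hh
  have hplane_c : Continuous (plane s) := by
    refine (PiLp.continuous_toLp 2 _).comp ?_
    refine continuous_pi fun i => ?_
    fin_cases i
    · exact PiLp.continuous_apply 2 _ 0
    · exact PiLp.continuous_apply 2 _ 1
    · exact continuous_const
  have hnorm_le : ∀ a : EuclideanSpace ℝ (Fin 2), ‖a‖ ≤ ‖plane s a‖ := by
    intro a
    have h2 : ‖a‖ ^ 2 ≤ ‖plane s a‖ ^ 2 := by
      rw [EuclideanSpace.norm_sq_eq, EuclideanSpace.norm_sq_eq, Fin.sum_univ_two, Fin.sum_univ_three]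
      simp [plane]
      nlinarith [sq_nonneg s]
    exact le_of_pow_le_pow_left₀ two_ne_zero (norm_nonneg _) h2
  set S' : Set (EuclideanSpace ℝ (Fin 2)) := plane s ⁻¹' ball (0 : EuclideanSpace ℝ (Fin 3)) R' with hS'
  have hS'm : MeasurableSet S' := measurableSet_ball.preimage hplane_c.measurable
  have hS'sub : S' ⊆ closedBall (0 : EuclideanSpace ℝ (Fin 2)) R' := by
    intro a ha
    rw [mem_closedBall, dist_zero_right]
    have : ‖plane s a‖ < R' := by simpa [hS'] using ha
    exact (hnorm_le a).trans this.le
  have hh_eq : h = S'.indicator (G ∘ plane s) := by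
    funext a
    simp only [hh, hS']
    exact (Set.indicator_comp_right (plane s) (s := ball (0 : EuclideanSpace ℝ (Fin 3)) R') (g := G)).symm
  have hh_int : Integrable h := by
    rw [hh_eq, integrable_indicator_iff hS'm]
    exact ((hGc.comp hplane_c).continuousOn.integrableOn_compact (isCompact_closedBall 0 R')).mono_set hS'sub
  have hh0 : ∀ a, 0 ≤ h a := fun a => Set.indicator_nonneg (fun x _ => hG0 x) _
  -- on the disc, the chart integrand is `h ∘ Φ`
  have hpt : ∀ z ∈ closedBall (0 : ℂ) r,
      G (y + z.re • EuclideanSpace.basisFun (Fin 3) ℝ 0 + z.im • EuclideanSpace.basisFun (Fin 3) ℝ 1) = h (Φ z) := by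
    intro z hz
    have heq := cchart_eq_plane y z
    simp only [hh, hΦ, hs, hc]
    rw [← heq, Set.indicator_of_mem]
    rw [mem_ball, dist_zero_right]
    rw [mem_closedBall, dist_zero_right] at hz
    exact (norm_cchart_le y z).trans_lt (by linarith)
  -- the chart as a measurable equivalence, and the comparison
  set Φe : ℂ ≃ᵐ EuclideanSpace ℝ (Fin 2) :=
    (Complex.measurableEquivRealProd.trans
      ((MeasurableEquiv.finTwoArrow (α := ℝ)).symm.trans (MeasurableEquiv.toLp 2 (Fin 2 → ℝ)))).trans
      (MeasurableEquiv.addLeft c) with hΦe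
  have hΦe_coe : ⇑Φe = Φ := by
    funext z
    simp [hΦe, hΦ, MeasurableEquiv.coe_addLeft, Complex.measurableEquivRealProd_apply]
  have hΦemp : MeasurePreserving Φe volume volume := by
    rw [hΦe_coe]; exact hΦmp
  have hcomp : ∫ z, h (Φe z) = ∫ a, h a := hΦemp.integral_comp' h
  have hint_comp : Integrable (fun z => h (Φe z)) :=
    (hΦemp.integrable_comp_emb Φe.measurableEmbedding).2 hh_int
  calc ∫ z in closedBall (0 : ℂ) r,
        G (y + z.re • EuclideanSpace.basisFun (Fin 3) ℝ 0 + z.im • EuclideanSpace.basisFun (Fin 3) ℝ 1)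
      = ∫ z in closedBall (0 : ℂ) r, h (Φe z) :=
        setIntegral_congr_fun measurableSet_closedBall fun z hz => by rw [hpt z hz, hΦe_coe]
    _ ≤ ∫ z, h (Φe z) := setIntegral_le_integral hint_comp (Filter.Eventually.of_forall fun z => hh0 _)
    _ = ∫ a, h a := hcomp

/-! ## §5 Disc budgets of the scalar `⟪V ∘ Φ_y, u⟫` from the slice budgets -/

/-- **Amplitude budget on the disc.**  For `V ∈ C¹(ℝ³,ℝ³)`, `‖u‖ ≤ 1`, `‖y‖ + r < R'`:
`∫_{closedBall (0:ℂ) r} ⟪V(Φ_y z), u⟫² dz ≤ ∫ a, 𝟙_{B(0,R')} ‖V‖² (plane (y 2) a)`. [folklore] -/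
theorem setIntegral_cdisc_sq_inner_le {V : EuclideanSpace ℝ (Fin 3) → EuclideanSpace ℝ (Fin 3)} (hV : ContDiff ℝ 1 V)
    {u : EuclideanSpace ℝ (Fin 3)} (hu : ‖u‖ ≤ 1) {y : EuclideanSpace ℝ (Fin 3)} {R' r : ℝ} (hfit : ‖y‖ + r < R') :
    ∫ z in closedBall (0 : ℂ) r,
        ⟪V (y + z.re • EuclideanSpace.basisFun (Fin 3) ℝ 0 + z.im • EuclideanSpace.basisFun (Fin 3) ℝ 1), u⟫ ^ 2 ≤
      ∫ a, (ball (0 : EuclideanSpace ℝ (Fin 3)) R').indicator (fun x => ‖V x‖ ^ 2) (plane (y 2) a) := by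
  have hVc : Continuous V := hV.continuous
  have hΦc := (contDiff_cchart y (n := 1)).continuous
  refine le_trans ?_ (setIntegral_cdisc_le_integral_plane (G := fun x => ‖V x‖ ^ 2) (hVc.norm.pow 2)
    (fun x => sq_nonneg _) hfit)
  refine setIntegral_mono_on ?_ ?_ measurableSet_closedBall fun z _ => sq_inner_le_norm_sq _ hu
  · exact (((hVc.comp hΦc).inner continuous_const).pow 2).continuousOn.integrableOn_compact
      (isCompact_closedBall _ _)
  · exact ((hVc.comp hΦc).norm.pow 2).continuousOn.integrableOn_compact (isCompact_closedBall _ _)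

/-- **Energy budget on the disc.**  For `V ∈ C¹(ℝ³,ℝ³)`, `‖u‖ ≤ 1`, `‖y‖ + r < R'`, `ψ z = ⟪V(Φ_y z), u⟫`:
`∫_{closedBall (0:ℂ) r} ‖Dψ‖² dz ≤ ∫ a, 𝟙_{B(0,R')} ‖DV‖² (plane (y 2) a)`. [folklore] -/
theorem setIntegral_cdisc_sq_norm_fderiv_inner_le {V : EuclideanSpace ℝ (Fin 3) → EuclideanSpace ℝ (Fin 3)}
    (hV : ContDiff ℝ 1 V) {u : EuclideanSpace ℝ (Fin 3)} (hu : ‖u‖ ≤ 1) {y : EuclideanSpace ℝ (Fin 3)} {R' r : ℝ}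
    (hfit : ‖y‖ + r < R') :
    ∫ z in closedBall (0 : ℂ) r, ‖fderiv ℝ (fun z : ℂ =>
        ⟪V (y + z.re • EuclideanSpace.basisFun (Fin 3) ℝ 0 + z.im • EuclideanSpace.basisFun (Fin 3) ℝ 1), u⟫) z‖ ^ 2 ≤
      ∫ a, (ball (0 : EuclideanSpace ℝ (Fin 3)) R').indicator (fun x => ‖fderiv ℝ V x‖ ^ 2) (plane (y 2) a) := by
  have hVd : Differentiable ℝ V := hV.differentiable one_ne_zero
  have hDVc : Continuous (fderiv ℝ V) := hV.continuous_fderiv one_ne_zero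
  have hΦc := (contDiff_cchart y (n := 1)).continuous
  have hψ : ContDiff ℝ 1 (fun z : ℂ =>
      ⟪V (y + z.re • EuclideanSpace.basisFun (Fin 3) ℝ 0 + z.im • EuclideanSpace.basisFun (Fin 3) ℝ 1), u⟫) :=
    contDiff_comp_cchart (f := fun x => ⟪V x, u⟫) (hV.inner ℝ contDiff_const) y
  refine le_trans ?_ (setIntegral_cdisc_le_integral_plane (G := fun x => ‖fderiv ℝ V x‖ ^ 2) (hDVc.norm.pow 2)
    (fun x => sq_nonneg _) hfit)
  refine setIntegral_mono_on ?_ ?_ measurableSet_closedBall fun z _ =>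
    pow_le_pow_left₀ (norm_nonneg _) (norm_fderiv_inner_comp_cchart_le hVd hu y z) 2
  · exact ((hψ.continuous_fderiv one_ne_zero).norm.pow 2).continuousOn.integrableOn_compact
      (isCompact_closedBall _ _)
  · exact ((hDVc.comp hΦc).norm.pow 2).continuousOn.integrableOn_compact (isCompact_closedBall _ _)

end Summit.NavierStokesRegularity.NavierStokesRegularity.Theorems.PowerGaugeEulerLiouville.Condenser

end
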